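import Literature.NumberTheory.DiophantineGeometry.SymmetricGroupRepsYoungSymmetrizerMulSelfProofs
import HarnessLib

/-!
# The character of a Specht module through its Young symmetrizer:
# `n_μ · χ^μ(σ) = ∑_{g ∈ S_d} c_μ(g⁻¹ σ⁻¹ g)` (Fulton–Harris, Lemma 4.26, proof technique)

For the Specht module `S^μ = k[S_d] c_μ` of `Literature.NumberTheory.DiophantineGeometry.SymmetricGroupReps`
(`c_μ = a_μ b_μ` the Young symmetrizer of the canonical row-reading tableau of shape `μ ⊢ d`,
`R_μ`, `C_μ` its row and column stabilizers, `χ^μ = spechtCharacter k μ` the character of the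
representation `spechtRep k μ` by left multiplication) this file PROVES, over a field `k`:

* `coeff_youngSymmetrizer_eq_sum_sum`, `…_eq_sum_colStabilizer`, `…_eq_sum_rowStabilizer`: the
  coefficients of the Young symmetrizer, `c_μ(π) = ∑_{p ∈ R_μ, q ∈ C_μ, pq = π} sgn q
  = ∑_{q ∈ C_μ, π q⁻¹ ∈ R_μ} sgn q = ∑_{p ∈ R_μ, p⁻¹π ∈ C_μ} sgn(p⁻¹ π)` (Fulton–Harris §4.2:
  "`c = ∑ ± e_g`, the sum over all `g` that can be written as `p · q`, with coefficient `sgn q`";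
  such a factorisation is unique as `R_μ ∩ C_μ = 1`);
* `trace_mulLeft_comp_mulRight`: for a finite group `G` and `x ∈ k[G]`, the trace on `k[G]` of
  `v ↦ σ v x` is `∑_{g ∈ G} x(g⁻¹ σ⁻¹ g)` (matrix in the basis `G`);
* `coeff_sq_mul_spechtCharacter` (**the character formula**, characteristic zero):
  `n_μ χ^μ(σ) = ∑_{g ∈ S_d} c_μ(g⁻¹ σ⁻¹ g)` with `n_μ = (c_μ²)_1` (`= d!/f^μ`,
  `youngSymmetrizer_sq`, `coeff_sq_youngSymmetrizer_eq`). Proof (the trace argument of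
  Fulton–Harris, Lemma 4.26): right multiplication `F` by `c_μ` maps `A = k[S_d]` onto
  `V = A c_μ` and is the scalar `n_μ` on `V`; left multiplication `L_σ` by `σ` commutes with it and
  restricts to `ρ(σ)` on `V`; hence `n_μ tr(ρ(σ)) = tr_V(ρ(σ) F' i) = tr_A(i ρ(σ) F') = tr_A(L_σ F)`
  (`F = i F'`, `F' i = n_μ`, `tr(fg) = tr(gf)`), and the last trace is read off in the basis of
  permutations. (Equivalently: the character afforded by the idempotent `e = c_μ/n_μ` is
  `χ(σ) = ∑_g e(g⁻¹ σ⁻¹ g)`.)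
* `coeff_sq_youngSymmetrizer_eq_sum`: `n_μ = (c_μ²)_1 = ∑_a c_μ(a) c_μ(a⁻¹)`;
* the same identities with `R_μ`, `C_μ` replaced by arbitrary decidable predicates describing them
  and the right-hand sides written as casts of INTEGER sums (`…_eq_intCast_col`, `…_eq_intCast_row`),
  which is the form in which they are evaluated by `decide` for `S_5` in
  `SymmetricGroupRepsS5CharacterTable`.

## References

* W. Fulton, J. Harris, *Representation Theory. A First Course*, GTM 129, Springer (1991),
  doi:10.1007/978-1-4612-0979-9: §4.2 (paragraph before Lemma 4.21), Lemma 4.26 and its proof;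
  §2.1 (characters, Proposition 2.1). [FultonHarrisGTM129]
* G. D. James, *The Representation Theory of the Symmetric Groups*, LNM 682 (1978), §§4, 6. [JamesLNM682]

## Design

Theorems only (no new definitions), in `namespace Literature.NumberTheory.DiophantineGeometry`
with the field `k` explicit as in `SymmetricGroupReps`; `n_μ` is kept as the expression
`(youngSymmetrizer k μ * youngSymmetrizer k μ).coeff 1`.
-/

noncomputable section

open scoped BigOperators

namespace Literature.NumberTheory.DiophantineGeometry

section CplxAlg

variable (k : Type*) [Field k] {d : ℕ}

/-! ### Coefficients of the Young symmetrizer -/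

open scoped Classical in
/-- `c_μ(π) = ∑_{p ∈ R_μ} ∑_{q ∈ C_μ} [p q = π] sgn q` (Fulton–Harris §4.2: `c = ∑ ± e_g` over the
`g = p · q`, with coefficient `sgn q`). [cite: FultonHarrisGTM129, §4.2 (paragraph before Lemma 4.21)] -/
theorem coeff_youngSymmetrizer_eq_sum_sum (μ : Nat.Partition d) (π : Equiv.Perm (Fin d)) :
    (youngSymmetrizer k μ).coeff π =
      ∑ p ∈ (rowStabilizer μ : Set (Equiv.Perm (Fin d))).toFinset,
        ∑ q ∈ (colStabilizer μ : Set (Equiv.Perm (Fin d))).toFinset,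
          if p * q = π then (((Equiv.Perm.sign q : ℤˣ) : ℤ) : k) else 0 := by
  simp only [youngSymmetrizer, rowSymmetrizer, colAntisymmetrizer, Finset.sum_mul_sum,
    MonoidAlgebra.of_apply, MonoidAlgebra.smul_single', mul_one, MonoidAlgebra.single_mul_single,
    one_mul, MonoidAlgebra.coeff_sum, MonoidAlgebra.coeff_single, Finsupp.finsetSum_apply,
    Finsupp.single_apply]

open scoped Classical in
/-- `c_μ(π) = ∑_{q ∈ C_μ, π q⁻¹ ∈ R_μ} sgn q`: for each `q ∈ C_μ` at most one `p = π q⁻¹` has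
`p q = π`. [cite: FultonHarrisGTM129, §4.2 (paragraph before Lemma 4.21)] -/
theorem coeff_youngSymmetrizer_eq_sum_colStabilizer (μ : Nat.Partition d) (π : Equiv.Perm (Fin d)) :
    (youngSymmetrizer k μ).coeff π =
      ∑ q ∈ (colStabilizer μ : Set (Equiv.Perm (Fin d))).toFinset,
        if π * q⁻¹ ∈ rowStabilizer μ then (((Equiv.Perm.sign q : ℤˣ) : ℤ) : k) else 0 := by
  rw [coeff_youngSymmetrizer_eq_sum_sum, Finset.sum_comm]
  refine Finset.sum_congr rfl fun q _ ↦ ?_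
  simp_rw [← eq_mul_inv_iff_mul_eq]
  rw [Finset.sum_ite_eq']
  simp only [Set.mem_toFinset, SetLike.mem_coe]

open scoped Classical in
/-- `c_μ(π) = ∑_{p ∈ R_μ, p⁻¹ π ∈ C_μ} sgn(p⁻¹ π)`: for each `p ∈ R_μ` at most one `q = p⁻¹ π` has
`p q = π`. [cite: FultonHarrisGTM129, §4.2 (paragraph before Lemma 4.21)] -/
theorem coeff_youngSymmetrizer_eq_sum_rowStabilizer (μ : Nat.Partition d) (π : Equiv.Perm (Fin d)) :
    (youngSymmetrizer k μ).coeff π =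
      ∑ p ∈ (rowStabilizer μ : Set (Equiv.Perm (Fin d))).toFinset,
        if p⁻¹ * π ∈ colStabilizer μ then (((Equiv.Perm.sign (p⁻¹ * π) : ℤˣ) : ℤ) : k) else 0 := by
  rw [coeff_youngSymmetrizer_eq_sum_sum]
  refine Finset.sum_congr rfl fun p _ ↦ ?_
  simp_rw [← eq_inv_mul_iff_mul_eq (b := p)]
  rw [Finset.sum_ite_eq']
  simp only [Set.mem_toFinset, SetLike.mem_coe]

/-- `c_μ(π) = ∑_{q : Q q, P (π q⁻¹)} sgn q` for any decidable descriptions `P`, `Q` of the row and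
column stabilizers (the computable form of `coeff_youngSymmetrizer_eq_sum_colStabilizer`). [folklore] -/
theorem coeff_youngSymmetrizer_eq_sum_filter_col (μ : Nat.Partition d)
    {P Q : Equiv.Perm (Fin d) → Prop} [DecidablePred P] [DecidablePred Q]
    (hR : ∀ p, p ∈ rowStabilizer μ ↔ P p) (hC : ∀ q, q ∈ colStabilizer μ ↔ Q q)
    (π : Equiv.Perm (Fin d)) :
    (youngSymmetrizer k μ).coeff π =
      ∑ q ∈ Finset.univ.filter Q, if P (π * q⁻¹) then (((Equiv.Perm.sign q : ℤˣ) : ℤ) : k) else 0 := by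
  classical
  rw [coeff_youngSymmetrizer_eq_sum_colStabilizer]
  refine Finset.sum_congr (by ext q; simp [hC]) fun q _ ↦ ?_
  simp only [hR]

/-- `c_μ(π) = ∑_{p : P p, Q (p⁻¹ π)} sgn(p⁻¹ π)` for any decidable descriptions `P`, `Q` of the row
and column stabilizers (the computable form of `coeff_youngSymmetrizer_eq_sum_rowStabilizer`). [folklore] -/
theorem coeff_youngSymmetrizer_eq_sum_filter_row (μ : Nat.Partition d)
    {P Q : Equiv.Perm (Fin d) → Prop} [DecidablePred P] [DecidablePred Q]
    (hR : ∀ p, p ∈ rowStabilizer μ ↔ P p) (hC : ∀ q, q ∈ colStabilizer μ ↔ Q q)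
    (π : Equiv.Perm (Fin d)) :
    (youngSymmetrizer k μ).coeff π =
      ∑ p ∈ Finset.univ.filter P,
        if Q (p⁻¹ * π) then (((Equiv.Perm.sign (p⁻¹ * π) : ℤˣ) : ℤ) : k) else 0 := by
  classical
  rw [coeff_youngSymmetrizer_eq_sum_rowStabilizer]
  refine Finset.sum_congr (by ext p; simp [hR]) fun p _ ↦ ?_
  simp only [hC]

/-- `(c_μ²)_1 = ∑_{a ∈ S_d} c_μ(a) c_μ(a⁻¹)` (the coefficient of `1` in a product in `k[G]`). [folklore] -/
theorem coeff_sq_youngSymmetrizer_eq_sum (μ : Nat.Partition d) :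
    (youngSymmetrizer k μ * youngSymmetrizer k μ).coeff 1 =
      ∑ a : Equiv.Perm (Fin d), (youngSymmetrizer k μ).coeff a * (youngSymmetrizer k μ).coeff a⁻¹ := by
  rw [MonoidAlgebra.coeff_mul_apply_left, Finsupp.sum_fintype _ _ fun _ ↦ by rw [zero_mul]]
  simp only [mul_one]

/-! ### The trace of `v ↦ σ v x` on `k[G]` -/

/-- For a finite group `G`, `σ ∈ G` and `x ∈ k[G]`, the trace of `v ↦ σ v x` on `k[G]` is
`∑_{g ∈ G} x(g⁻¹ σ⁻¹ g)`: in the basis of group elements the diagonal entry at `g` is the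
coefficient of `g` in `σ g x`. [folklore] -/
theorem trace_mulLeft_comp_mulRight {G : Type*} [Group G] [Fintype G] [DecidableEq G]
    (σ : G) (x : MonoidAlgebra k G) :
    LinearMap.trace k _ (LinearMap.mulLeft k (MonoidAlgebra.single σ (1 : k)) ∘ₗ
        LinearMap.mulRight k x) = ∑ g : G, x.coeff (g⁻¹ * σ⁻¹ * g) := by
  rw [LinearMap.trace_eq_matrix_trace k (MonoidAlgebra.basis G k), Matrix.trace]
  refine Finset.sum_congr rfl fun g _ ↦ ?_
  rw [Matrix.diag_apply, LinearMap.toMatrix_apply, MonoidAlgebra.basis_apply, LinearMap.comp_apply,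
    LinearMap.mulRight_apply, LinearMap.mulLeft_apply]
  change (MonoidAlgebra.single σ 1 * (MonoidAlgebra.single g 1 * x)).coeff g = _
  rw [MonoidAlgebra.coeff_single_mul_apply, one_mul, MonoidAlgebra.coeff_single_mul_apply, one_mul,
    mul_assoc]

/-! ### The character formula -/

/-- **The character of the Specht module through the Young symmetrizer** (characteristic zero):
`n_μ · χ^μ(σ) = ∑_{g ∈ S_d} c_μ(g⁻¹ σ⁻¹ g)`, where `n_μ = (c_μ²)_1` (`c_μ² = n_μ c_μ`,
`youngSymmetrizer_sq`; `n_μ = d!/f^μ`, `coeff_sq_youngSymmetrizer_eq`). The trace argument of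
Fulton–Harris, Lemma 4.26 (proof), applied to `L_σ ∘ F` instead of `F` (`F` = right multiplication
by `c_μ`, the scalar `n_μ` on `V_μ = A c_μ`; `L_σ` = left multiplication by `σ`, which is `ρ(σ)` on
`V_μ`): `n_μ tr(ρ(σ)) = tr_A(L_σ F)`, computed in the basis of permutations
(`trace_mulLeft_comp_mulRight`). [cite: FultonHarrisGTM129, Lemma 4.26 (proof)] -/
theorem coeff_sq_mul_spechtCharacter [CharZero k] (μ : Nat.Partition d) (σ : Equiv.Perm (Fin d)) :
    (youngSymmetrizer k μ * youngSymmetrizer k μ).coeff 1 * spechtCharacter k μ σ =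
      ∑ g : Equiv.Perm (Fin d), (youngSymmetrizer k μ).coeff (g⁻¹ * σ⁻¹ * g) := by
  classical
  set c := youngSymmetrizer k μ with hc
  set n := (c * c).coeff 1 with hn
  -- the inclusion `i : V → A` and the corestriction `F' : A → V` of right multiplication by `c`
  set i : spechtIdeal k μ →ₗ[k] MonoidAlgebra k (Equiv.Perm (Fin d)) :=
    (Submodule.subtype (spechtIdeal k μ)).restrictScalars k with hi
  have hmem : ∀ v : MonoidAlgebra k (Equiv.Perm (Fin d)),
      LinearMap.mulRight (MonoidAlgebra k (Equiv.Perm (Fin d))) c v ∈ spechtIdeal k μ := fun v ↦ by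
    rw [LinearMap.mulRight_apply]
    exact Ideal.mul_mem_left _ v (youngSymmetrizer_mem_spechtIdeal k μ)
  set F' : MonoidAlgebra k (Equiv.Perm (Fin d)) →ₗ[k] spechtIdeal k μ :=
    (LinearMap.codRestrict (spechtIdeal k μ)
      (LinearMap.mulRight (MonoidAlgebra k (Equiv.Perm (Fin d))) c) hmem).restrictScalars k with hF'
  set L : MonoidAlgebra k (Equiv.Perm (Fin d)) →ₗ[k] MonoidAlgebra k (Equiv.Perm (Fin d)) :=
    LinearMap.mulLeft k (MonoidAlgebra.single σ (1 : k)) with hL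
  -- `i ∘ F' = F`, `F' ∘ i = n • id`, `i ∘ ρ(σ) = L ∘ i`
  have h1 : i ∘ₗ F' = LinearMap.mulRight k c := by
    apply LinearMap.ext
    intro v
    simp only [hi, hF', LinearMap.coe_comp, Function.comp_apply, LinearMap.coe_restrictScalars,
      Submodule.coe_subtype, LinearMap.codRestrict_apply, LinearMap.mulRight_apply]
  have h2 : F' ∘ₗ i = n • LinearMap.id := by
    apply LinearMap.ext
    intro v
    apply Subtype.ext
    obtain ⟨y, hy⟩ := Ideal.mem_span_singleton'.1 v.2
    simp only [hi, hF', LinearMap.coe_comp, Function.comp_apply, LinearMap.coe_restrictScalars,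
      Submodule.coe_subtype, LinearMap.codRestrict_apply, LinearMap.mulRight_apply,
      LinearMap.smul_apply, LinearMap.id_coe, id_eq, Submodule.coe_smul_of_tower]
    rw [← hy, mul_assoc, ← hc, youngSymmetrizer_sq k μ, ← hc, ← hn, mul_smul_comm]
  have h3 : i ∘ₗ (spechtRep k μ σ) = L ∘ₗ i := by
    apply LinearMap.ext
    intro v
    simp only [hi, hL, LinearMap.coe_comp, Function.comp_apply, LinearMap.coe_restrictScalars,
      Submodule.coe_subtype, LinearMap.mulLeft_apply]
    exact spechtRep_apply k μ σ v
  -- `n tr(ρ σ) = tr(ρ σ ∘ F' ∘ i) = tr(i ∘ ρ σ ∘ F') = tr(L ∘ i ∘ F') = tr(L ∘ F)`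
  have h4 : n * spechtCharacter k μ σ =
      LinearMap.trace k (spechtIdeal k μ) ((spechtRep k μ σ) ∘ₗ (F' ∘ₗ i)) := by
    rw [h2, LinearMap.comp_smul, map_smul, LinearMap.comp_id, smul_eq_mul, spechtCharacter_apply]
  rw [h4, ← LinearMap.comp_assoc, LinearMap.trace_comp_comm', ← LinearMap.comp_assoc, h3,
    LinearMap.comp_assoc, h1, hL]
  exact trace_mulLeft_comp_mulRight k σ c

/-! ### Integer forms for evaluation -/

/-- The character formula with the stabilizers described by decidable predicates `P` (rows) and
`Q` (columns), inner sum over the column stabilizer, as the cast of an integer: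
`n_μ χ^μ(σ) = ∑_g ∑_{q : Q q} [P (g⁻¹σ⁻¹g q⁻¹)] sgn q`. [folklore] -/
theorem coeff_sq_mul_spechtCharacter_eq_intCast_col [CharZero k] (μ : Nat.Partition d)
    {P Q : Equiv.Perm (Fin d) → Prop} [DecidablePred P] [DecidablePred Q]
    (hR : ∀ p, p ∈ rowStabilizer μ ↔ P p) (hC : ∀ q, q ∈ colStabilizer μ ↔ Q q)
    (σ : Equiv.Perm (Fin d)) :
    (youngSymmetrizer k μ * youngSymmetrizer k μ).coeff 1 * spechtCharacter k μ σ =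
      ((∑ g : Equiv.Perm (Fin d), ∑ q ∈ Finset.univ.filter Q,
        if P (g⁻¹ * σ⁻¹ * g * q⁻¹) then ((Equiv.Perm.sign q : ℤˣ) : ℤ) else 0 : ℤ) : k) := by
  rw [coeff_sq_mul_spechtCharacter]
  push_cast
  exact Finset.sum_congr rfl fun g _ ↦ coeff_youngSymmetrizer_eq_sum_filter_col k μ hR hC _

/-- The character formula with the stabilizers described by decidable predicates `P` (rows) and
`Q` (columns), inner sum over the row stabilizer, as the cast of an integer:
`n_μ χ^μ(σ) = ∑_g ∑_{p : P p} [Q (p⁻¹ g⁻¹σ⁻¹g)] sgn(p⁻¹ g⁻¹σ⁻¹g)`. [folklore] -/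
theorem coeff_sq_mul_spechtCharacter_eq_intCast_row [CharZero k] (μ : Nat.Partition d)
    {P Q : Equiv.Perm (Fin d) → Prop} [DecidablePred P] [DecidablePred Q]
    (hR : ∀ p, p ∈ rowStabilizer μ ↔ P p) (hC : ∀ q, q ∈ colStabilizer μ ↔ Q q)
    (σ : Equiv.Perm (Fin d)) :
    (youngSymmetrizer k μ * youngSymmetrizer k μ).coeff 1 * spechtCharacter k μ σ =
      ((∑ g : Equiv.Perm (Fin d), ∑ p ∈ Finset.univ.filter P,
        if Q (p⁻¹ * (g⁻¹ * σ⁻¹ * g)) then ((Equiv.Perm.sign (p⁻¹ * (g⁻¹ * σ⁻¹ * g)) : ℤˣ) : ℤ)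
        else 0 : ℤ) : k) := by
  rw [coeff_sq_mul_spechtCharacter]
  push_cast
  exact Finset.sum_congr rfl fun g _ ↦ coeff_youngSymmetrizer_eq_sum_filter_row k μ hR hC _

/-- `n_μ = (c_μ²)_1` as the cast of an integer, stabilizers described by decidable predicates, inner
sums over the column stabilizer: `n_μ = ∑_a (∑_{q : Q q} [P (a q⁻¹)] sgn q)(∑_{q : Q q} [P (a⁻¹ q⁻¹)] sgn q)`. [folklore] -/
theorem coeff_sq_youngSymmetrizer_eq_intCast_col (μ : Nat.Partition d)
    {P Q : Equiv.Perm (Fin d) → Prop} [DecidablePred P] [DecidablePred Q]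
    (hR : ∀ p, p ∈ rowStabilizer μ ↔ P p) (hC : ∀ q, q ∈ colStabilizer μ ↔ Q q) :
    (youngSymmetrizer k μ * youngSymmetrizer k μ).coeff 1 =
      ((∑ a : Equiv.Perm (Fin d),
        (∑ q ∈ Finset.univ.filter Q, if P (a * q⁻¹) then ((Equiv.Perm.sign q : ℤˣ) : ℤ) else 0) *
        (∑ q ∈ Finset.univ.filter Q, if P (a⁻¹ * q⁻¹) then ((Equiv.Perm.sign q : ℤˣ) : ℤ) else 0) :
          ℤ) : k) := by
  rw [coeff_sq_youngSymmetrizer_eq_sum]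
  push_cast
  refine Finset.sum_congr rfl fun a _ ↦ ?_
  rw [coeff_youngSymmetrizer_eq_sum_filter_col k μ hR hC,
    coeff_youngSymmetrizer_eq_sum_filter_col k μ hR hC]

/-- `n_μ = (c_μ²)_1` as the cast of an integer, stabilizers described by decidable predicates, inner
sums over the row stabilizer. [folklore] -/
theorem coeff_sq_youngSymmetrizer_eq_intCast_row (μ : Nat.Partition d)
    {P Q : Equiv.Perm (Fin d) → Prop} [DecidablePred P] [DecidablePred Q]
    (hR : ∀ p, p ∈ rowStabilizer μ ↔ P p) (hC : ∀ q, q ∈ colStabilizer μ ↔ Q q) :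
    (youngSymmetrizer k μ * youngSymmetrizer k μ).coeff 1 =
      ((∑ a : Equiv.Perm (Fin d),
        (∑ p ∈ Finset.univ.filter P,
          if Q (p⁻¹ * a) then ((Equiv.Perm.sign (p⁻¹ * a) : ℤˣ) : ℤ) else 0) *
        (∑ p ∈ Finset.univ.filter P,
          if Q (p⁻¹ * a⁻¹) then ((Equiv.Perm.sign (p⁻¹ * a⁻¹) : ℤˣ) : ℤ) else 0) : ℤ) : k) := by
  rw [coeff_sq_youngSymmetrizer_eq_sum]
  push_cast
  refine Finset.sum_congr rfl fun a _ ↦ ?_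
  rw [coeff_youngSymmetrizer_eq_sum_filter_row k μ hR hC,
    coeff_youngSymmetrizer_eq_sum_filter_row k μ hR hC]

end CplxAlg

end Literature.NumberTheory.DiophantineGeometry
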